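import Mathlib
import Summits.KontsevichZagierPeriods.Zeta5Search.SecondOrderTypes
import Summits.KontsevichZagierPeriods.Zeta5Search.CellKitLevel
import HarnessLib

/-!
# ζ(5) search — zero-window kit: the type list of the conjugate class is the reversed type list

Cell `pub-zeta5` (HONEST FRAMING: systematic search; no irrationality claim unless certified), prover seat p3 generation 3.
One bookkeeping lemma used by the discharge of census g21's `ZeroWindows.RecZeroClassesM..` class-structure statements
(`Zeta5Search/ZeroWindowClasses.lean`): for a level class with base `x < p` and top level `L` (`x + Lp ≤ b₀ < x + (L+1)p`, `0 ≤ b₀`)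
the conjugate class `conjClass b p x` (base `b₀ − x − Lp`) has the same number of points and carries the REVERSED type list,
`classTypeList b p (conjClass b p x) = (classTypeList b p x).reverse` — assembled from the tree lemmas `CellKit.conj_level`,
`CellKit.netExp_conj_level` (reflection `netExp (b₀ − s) = netExp s`) and `SecondOrder.classTypeList_level`.
Integer bookkeeping of a systematic search; nothing here bears on irrationality.
-/

namespace Summit.KontsevichZagierPeriods.Zeta5Search.ZeroWindows

open Summit.KontsevichZagierPeriods.Zeta5Search.ClusterValuation (netExp conjClass map_range_reverse)
open Summit.KontsevichZagierPeriods.Zeta5Search.SecondOrder (classTypeList classTypeList_level)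
open Summit.KontsevichZagierPeriods.Zeta5Search.CellKit (conj_level netExp_conj_level)

/-- **The conjugate class carries the reversed type list**: for `x < p`, `x + Lp ≤ b₀ < x + (L+1)p` and `0 ≤ b₀`,
`classTypeList b p (conjClass b p x) = (classTypeList b p x).reverse`. -/
theorem classTypeList_conj (b : ℕ → ℤ) (h0 : 0 ≤ b 0) {p x L : ℕ} (hx : x < p) (hL : x + L * p ≤ (b 0).toNat)
    (hL' : (b 0).toNat < x + L * p + p) :
    classTypeList b p (conjClass b p x) = (classTypeList b p x).reverse := by
  obtain ⟨-, hM, hM'⟩ := conj_level b hx hL hL'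
  rw [classTypeList_level b hM hM', classTypeList_level b hL hL', map_range_reverse]
  exact List.map_congr_left fun k hk => netExp_conj_level b hL hL' h0 (Nat.lt_succ_iff.1 (List.mem_range.1 hk))

end Summit.KontsevichZagierPeriods.Zeta5Search.ZeroWindows
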